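import Literature.AnabelianGeometry.SemiGraphs.TemperedAnabelianLem63iiProofs
import Literature.AnabelianGeometry.SemiGraphs.TemperedAnabelianSec6OfTowerProofs
import Literature.AnabelianGeometry.SemiGraphs.TemperedDeltaNormalizers
import HarnessLib

/-!
# [SemiAnbd] Lemma 6.3 (ii) for `Δ^temp_X` and the printed fact Lemma 6.3 (ii)(iii), from the tower

Mochizuki, *Semi-graphs of anabelioids*, Publ. RIMS **42** (2006) [SemiAnbd], §6, Lemma 6.3 (ii), (iii),
author's manuscript p. 70: "Let `F` be either `Π^temp_{X_K}` or `Δ^temp_X` … (ii) a subgroup `H ⊆ F` is of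
DFG-type if and only if it is of DOF-type. (iii) … for any `f ∈ F̂` such that `f · F₁ · f⁻¹ = F₂`, it
follows that `f ∈ F`." [cite: MochizukiSemiAnbd2006, Lem 6.3(ii)-(iii) p.70]

PROOF-ONLY companion (abc-iut cell, sub-DAG `SemiAnbd:Lem6.3(ii)`, prover abc-iut-w5-d240; no
definitions, no named facts introduced; de-duplicated with abc-iut-w5-d139's
`TemperedDeltaNormalizers.lean`, which owns Lemma 6.1 (ii)(iii) and the `Δ`-half of 6.3 (iii)):

* `TemperedCurve.deltaTempDFGIffDOF_of_tower` — the `Δ^temp`-half of Lemma 6.3 (ii) (typed node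
  `X.DeltaTempDFGIffDOF`, fact `F-1661`) for a datum carrying the group-level parameter bundle
  `d : X.GroupLevelData` (tempered, Galois-countable), modulo the single tower input for `Π^temp_{X_K}`:
  the completion hypothesis is `isProfiniteCompletion_deltaToHat d` and the tower for `Δ^temp_X` is
  `deltaTemp_tower_of_tower d` (both abc-iut-w5-d139), the virtually-free-quotients input then follows
  by `virtuallyFreeQuotients_of_tower`;
* `TemperedCurve.denseSubgroups_of_tower` — all four clauses of Lemma 6.3 (ii)(iii) for such `X`;
* `TemperedOrigin.denseSubgroupsHolds_of_tower` — the printed, origin-quantified fact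
  `Ω.DenseSubgroupsHolds` (`F-1705`) from the STRUCTURAL inputs: every certified `X` carries a
  `GroupLevelData` and satisfies the tower input ([André 2003, §4.5]).

Classical topological group theory + bookkeeping; nothing here concerns the disputed parts of
inter-universal Teichmüller theory or takes a side on [IUTchIII] Cor. 3.12; typed ≠ discharged.
-/

noncomputable section

namespace Literature.AnabelianGeometry.SemiGraphs

open _root_.Topology

namespace TemperedCurve

variable {p : ℕ} [Fact p.Prime] (X : TemperedCurve p)

/-- **[SemiAnbd] Lemma 6.3 (ii) for `F = Δ^temp_X`** — the typed node `X.DeltaTempDFGIffDOF` — for a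
datum with group-level parameters `d : X.GroupLevelData`, modulo the tower input for `Π^temp_{X_K}`
(from which `Δ_X = (Δ^temp_X)^` — `isProfiniteCompletion_deltaToHat` — and the tower for `Δ^temp_X` —
`deltaTemp_tower_of_tower` — follow). [cite: MochizukiSemiAnbd2006, Lem 6.3(ii) p.70] -/
theorem deltaTempDFGIffDOF_of_tower (d : X.GroupLevelData)
    (htower₀ : ∀ U ∈ 𝓝 (1 : X.PiTemp), ∃ N : OpenNormalSubgroup X.PiTemp, (N : Set X.PiTemp) ⊆ U ∧
      ∃ (G : Subgroup (X.PiTemp ⧸ N.toSubgroup)) (_ : IsFreeGroup G), G.Normal ∧ G.FiniteIndex ∧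
        Finite (IsFreeGroup.Generators G) ∧ ∃ a ∈ G, ∃ b ∈ G, a * b ≠ b * a) :
    X.DeltaTempDFGIffDOF :=
  X.deltaTempDFGIffDOF_of_virtuallyFreeQuotients (X.isProfiniteCompletion_deltaToHat d)
    (virtuallyFreeQuotients_of_tower (X.deltaTemp_tower_of_tower d htower₀))

/-- **[SemiAnbd] Lemma 6.3 (ii) and (iii), both cases `F = Π^temp_{X_K}` and `F = Δ^temp_X`** — the
`X`-instance of the typed fact `TemperedOrigin.DenseSubgroupsHolds` — for a tempered, Galois-countable
`X` (`d : X.GroupLevelData`), modulo the single tower input for `Π^temp_{X_K}`.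
[cite: MochizukiSemiAnbd2006, Lem 6.3(ii)-(iii) p.70] -/
theorem denseSubgroups_of_tower (d : X.GroupLevelData)
    (htower₀ : ∀ U ∈ 𝓝 (1 : X.PiTemp), ∃ N : OpenNormalSubgroup X.PiTemp, (N : Set X.PiTemp) ⊆ U ∧
      ∃ (G : Subgroup (X.PiTemp ⧸ N.toSubgroup)) (_ : IsFreeGroup G), G.Normal ∧ G.FiniteIndex ∧
        Finite (IsFreeGroup.Generators G) ∧ ∃ a ∈ G, ∃ b ∈ G, a * b ≠ b * a) :
    X.PiTempDFGIffDOF ∧ X.DeltaTempDFGIffDOF ∧ X.PiTempDenseDOFConjugator ∧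
      X.DeltaTempDenseDOFConjugator :=
  ⟨X.piTempDFGIffDOF_of_virtuallyFreeQuotients (virtuallyFreeQuotients_of_tower htower₀),
    X.deltaTempDFGIffDOF_of_tower d htower₀, X.denseDOFConjugators_of_tower d htower₀⟩

end TemperedCurve

namespace TemperedOrigin

variable {p : ℕ} [Fact p.Prime]

/-- **[SemiAnbd] Lemma 6.3 (ii), (iii) as printed** (`Ω.DenseSubgroupsHolds`, fact `F-1705`): for every
certified `X` and `F = Π^temp_{X_K}`, `Δ^temp_X`, DFG-type ⟺ DOF-type, and DOF-type subgroups dense in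
`F̂` are conjugate in `F̂` only by elements of `F` — from the STRUCTURAL origin-level inputs `hstruct`:
every certified `X` carries the group-level parameter bundle (`Π^temp_{X_K}` tempered and
Galois-countable) and satisfies the virtually free tower input ([André 2003, §4.5]).
[cite: MochizukiSemiAnbd2006, Lem 6.3(ii)-(iii) p.70] -/
theorem denseSubgroupsHolds_of_tower (Ω : TemperedOrigin p)
    (hstruct : ∀ X : TemperedCurve p, Ω.IsHyperbolicCurveOrigin X →
      Nonempty X.GroupLevelData ∧
      ∀ U ∈ 𝓝 (1 : X.PiTemp), ∃ N : OpenNormalSubgroup X.PiTemp, (N : Set X.PiTemp) ⊆ U ∧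
        ∃ (G : Subgroup (X.PiTemp ⧸ N.toSubgroup)) (_ : IsFreeGroup G), G.Normal ∧ G.FiniteIndex ∧
          Finite (IsFreeGroup.Generators G) ∧ ∃ a ∈ G, ∃ b ∈ G, a * b ≠ b * a) :
    Ω.DenseSubgroupsHolds := fun X hX => by
  obtain ⟨⟨d⟩, hPi⟩ := hstruct X hX
  exact X.denseSubgroups_of_tower d hPi

end TemperedOrigin

end Literature.AnabelianGeometry.SemiGraphs

end
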